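import Summits.QuantumFields.YangMills.Theorems.UnitScaleTiltProp8ChartDefs
import Summits.QuantumFields.YangMills.Theorems.UnitScaleTiltProp8IterPlaqSmall
import HarnessLib

/-!
# Route `UnitScaleTilt`, crux K1 «MinimiserStabilityRegPr» (stmt-QuantumFields-19200), leaf V2′ `stub_halvingStep` — pillar P3 `ChartPerLevel`, PINNING:
# **ON A CONFIGURATION OF (6)(ε₀) THE UNGUARDED ITERATE `emlIterU k` IS THE FAMILY'S k-FOLD (0.4)-DESCENT** (so `Prop8Chart.chartQ` is the
# constraint map of the stub's fibre `InB`, not a look-alike)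

Cell `ym3-torus` ∕ fleet seat `ym-ust-19200-p2` g5 (v8 PEN).  The vet of the v8 pillars (AUDIT-19200-pillars §3, §8 «pinning rule») requires the chart's
`C`/`Qlin` to be PINNED to the TRUE k-fold (0.4) descent of the family.  `Prop8ChartDefs` defines the analytic (unguarded) average `emlAvgU` / `emlIterU` and
proves the ONE-STEP bridge on the guard (`coe_emlAvgU_unitsField`).  This file iterates it: if the (0.4) loop variables of every iterated average
`Ū^{(i)}`, `i < k`, are `δ_N`-small (the guard holds at every level), then `emlIterU i` of the field read in `M_N(ℂ)ˣ` has the same matrices as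
`Averaging.iter (blockAvg ℰp) i U` for every `i ≤ k` (`coe_emlIterU_unitsField`); and AT THE d = 3 CARRIER the level-wise guard follows from the plaquette
clause of (6)(ε₀) alone by the k-uniform multi-level plaquette smallness of `IterPlaqSmall.plaqSmall_iter_T3_lt` (block size `L ≥ 7`, `2·10⁸L³ε₀ ≤ 1`):
`coe_emlIterU_unitsField_T3`.  Sorry-free, definition-free.  NOT a claim about the mass gap.

References: T. Bałaban, CMP **109** (1987) 249–301 [Balaban1987RG1] ((0.4), (0.11) p.253); CMP **102** (1985) 277–309 [Balaban1985Variational] ((2) p.278,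
(146) p.301, (156) p.302).
-/

noncomputable section

open scoped BigOperators Matrix.Norms.L2Operator

namespace Summit.QuantumFields.YangMills.Theorems.Prop8Chart

open Literature.MathematicalPhysics.QuantumFieldTheory.Balaban1983to89
open T4Continuum BlockAveraging ExpMeanLog LatticeWordStokes
open B10Eq27TorusAxialLog (unitsField toUField val_unitsField val_suIncl)
open Summit.QuantumFields.YangMills.Theorems.IterPlaqSmall (plaqSmall_iter_T3_lt one_div_fifty_lt_deltaSU_fin_two)

/-! ## §1 The k-fold bridge on the guard -/

section IterBridge

variable {P : Params} {N : ℕ}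

/-- The `SU(N)` field read in `M_N(ℂ)ˣ` has the same matrices. [cite: Balaban1985Averaging, (19) p.21] -/
theorem coe_unitsField_toUField {j : ℕ} (V : GaugeField P j (Matrix.specialUnitaryGroup (Fin N) ℂ)) (b : PBond P j) :
    ((unitsField (toUField V) b : (Matrix (Fin N) (Fin N) ℂ)ˣ) : Matrix (Fin N) (Fin N) ℂ) =
      ((V b : Matrix.specialUnitaryGroup (Fin N) ℂ) : Matrix (Fin N) (Fin N) ℂ) := by
  rw [val_unitsField]; rfl

variable [NeZero N]

/-- **THE k-FOLD BRIDGE**: if the (0.4) loop variables of every iterated average `Ū^{(i)}`, `i < k`, are `δ_N`-small at every coarse bond (the guard holds at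
every level), then for every `i ≤ k` the unguarded iterate `emlIterU i` of the field read in `M_N(ℂ)ˣ` has the SAME MATRICES as the tree's `Ū^{(i)} =
Averaging.iter (blockAvg ℰp) i U`. [cite: Balaban1987RG1, (0.4) and (0.11) p.253] -/
theorem coe_emlIterU_unitsField (U : GaugeField P 0 (Matrix.specialUnitaryGroup (Fin N) ℂ)) (k : ℕ)
    (hsmall : ∀ i, i < k → ∀ c : PBond P (i + 1),
      Small (expMeanLogSU (n := Fin N)) (Averaging.iter (fun j => blockAvg (P := P) (j := j) (expMeanLogSU (n := Fin N))) i U) c) :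
    ∀ i, i ≤ k → ∀ b : PBond P i,
      ((emlIterU i (unitsField (toUField U)) b : (Matrix (Fin N) (Fin N) ℂ)ˣ) : Matrix (Fin N) (Fin N) ℂ) =
        ((Averaging.iter (fun j => blockAvg (P := P) (j := j) (expMeanLogSU (n := Fin N))) i U b : Matrix.specialUnitaryGroup (Fin N) ℂ) :
          Matrix (Fin N) (Fin N) ℂ)
  | 0, _, b => by rw [emlIterU_zero, coe_unitsField_toUField]; rfl
  | i + 1, hi, c => by
    have hik : i < k := Nat.lt_of_succ_le hi
    -- by induction the level-`i` fields agree as units-valued fields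
    have hfun : emlIterU i (unitsField (toUField U)) =
        unitsField (toUField (Averaging.iter (fun j => blockAvg (P := P) (j := j) (expMeanLogSU (n := Fin N))) i U)) := by
      funext b
      apply Units.ext
      rw [coe_emlIterU_unitsField U k hsmall i hik.le b, coe_unitsField_toUField]
    rw [emlIterU_succ, hfun, coe_emlAvgU_unitsField _ c (hsmall i hik c)]
    rfl

end IterBridge

/-! ## §2 At the d = 3 carrier: the guard at every level from (6)(ε₀) -/

section T3

open T3ContinuumYM3Torus T3RegularMinimiser

/-- **THE GUARD HOLDS AT EVERY LEVEL ON (6)(ε₀)** (`L ≥ 7`, `0 < ε₀`, `2·10⁸L³ε₀ ≤ 1`): the (0.4) loop variables of every iterated average `Ū^{(i)}`, `i < K − n`,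
of a configuration with plaquettes within `ε₀L^{−2(K−n)}` of `1` are `δ₂`-small (`IterPlaqSmall.plaqSmall_iter_T3_lt` + `LatticeWordStokes.small_of_plaqSmall`).
[cite: Balaban1985Variational, (146) p.301; Balaban1987RG1, (0.4) p.253] -/
theorem small_iter_T3 (F : T3Family) (n K : ℕ) (hL : 7 ≤ F.L) {ε₀ : ℝ} (hε₀ : 0 < ε₀)
    (hε : 2 * 10 ^ 8 * (F.L : ℝ) ^ 3 * ε₀ ≤ 1)
    (U : GaugeField (F.P K) 0 (Matrix.specialUnitaryGroup (Fin 2) ℂ)) (hU : PlaqSmall (regThreshold F n K ε₀) U) :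
    ∀ i, i < K - n → ∀ c : PBond (F.P K) (i + 1),
      Small (expMeanLogSU (n := Fin 2)) (Averaging.iter (fun j => blockAvg (P := F.P K) (j := j) (expMeanLogSU (n := Fin 2))) i U) c := by
  intro i hik c
  have hL7 : (7 : ℝ) ≤ F.L := by exact_mod_cast hL
  have hL0 : (0 : ℝ) < F.L := by linarith
  have hε' : 50 * (500 * (F.L : ℝ) + 7 * (F.L : ℝ) ^ 2) * ε₀ ≤ 1 := by
    refine le_trans ?_ hε
    have hL1 : (1 : ℝ) ≤ F.L := by linarith
    have h1 : (F.L : ℝ) ≤ (F.L : ℝ) ^ 3 := le_self_pow₀ hL1 (by norm_num)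
    have h2 : (F.L : ℝ) ^ 2 ≤ (F.L : ℝ) ^ 3 := pow_le_pow_right₀ hL1 (by norm_num)
    nlinarith
  have hplaq := plaqSmall_iter_T3_lt F n K hL hε₀ hε' U hU i hik
  have ht0 : (0 : ℝ) ≤ 505 * ε₀ / (F.L : ℝ) ^ 2 := by positivity
  refine small_of_plaqSmall (expMeanLogSU (n := Fin 2)) ht0 hplaq ?_ c
  -- `((d+2)L)²/4 · 505ε₀/L² = (25·505/4)·ε₀ ≤ 1/50 < δ₂`
  have hd : (F.P K).d = 3 := T3Family.P_d F K
  have hLL : ((F.P K).L : ℝ) = F.L := rfl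
  rw [expMeanLogSU_δ, hd]
  push_cast
  rw [hLL, Fintype.card_fin]
  have hδ := one_div_fifty_lt_deltaSU_fin_two
  rw [deltaSU, Fintype.card_fin] at hδ
  refine lt_of_le_of_lt ?_ hδ
  rw [show (5 * (F.L : ℝ)) ^ 2 / 4 * (505 * ε₀ / (F.L : ℝ) ^ 2) = 25 * 505 / 4 * ε₀ by field_simp; norm_num]
  have hL3 : (343 : ℝ) ≤ (F.L : ℝ) ^ 3 := by nlinarith
  nlinarith

/-- **PINNING AT THE d = 3 CARRIER**: for a configuration of (6)(ε₀) (plaquettes within `ε₀L^{−2(K−n)}` of `1`; `L ≥ 7`, `0 < ε₀`, `2·10⁸L³ε₀ ≤ 1`), for every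
`i ≤ K − n` and every level-`i` bond the unguarded iterate `emlIterU i` of the field read in `M₂(ℂ)ˣ` IS the family's `i`-fold (0.4)-descent
`Averaging.iter (blockAvg ℰp) i U` as matrices — so `chartQ η (cubeSeqT3 …)` evaluated on the logarithm of such a field reproduces exactly its multi-level
(0.4) data. [cite: Balaban1985Variational, (156) p.302; Balaban1987RG1, (0.11) p.253] -/
theorem coe_emlIterU_unitsField_T3 (F : T3Family) (n K : ℕ) (hL : 7 ≤ F.L) {ε₀ : ℝ} (hε₀ : 0 < ε₀)
    (hε : 2 * 10 ^ 8 * (F.L : ℝ) ^ 3 * ε₀ ≤ 1)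
    (U : GaugeField (F.P K) 0 (Matrix.specialUnitaryGroup (Fin 2) ℂ)) (hU : PlaqSmall (regThreshold F n K ε₀) U) :
    ∀ i, i ≤ K - n → ∀ b : PBond (F.P K) i,
      ((emlIterU i (unitsField (toUField U)) b : (Matrix (Fin 2) (Fin 2) ℂ)ˣ) : Matrix (Fin 2) (Fin 2) ℂ) =
        ((Averaging.iter (fun j => blockAvg (P := F.P K) (j := j) (expMeanLogSU (n := Fin 2))) i U b : Matrix.specialUnitaryGroup (Fin 2) ℂ) :
          Matrix (Fin 2) (Fin 2) ℂ) :=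
  coe_emlIterU_unitsField U (K - n) (small_iter_T3 F n K hL hε₀ hε U hU)

end T3

end Summit.QuantumFields.YangMills.Theorems.Prop8Chart

end
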